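import Summits.BirchSwinnertonDyer.BirchSwinnertonDyer.Theorems.KatoDescentTamePotSupersingularTameUpperMuRoadFiveRecordsSplit01
import Summits.BirchSwinnertonDyer.BirchSwinnertonDyer.Theorems.KatoDescentTamePotSupersingularTameUpperMuRoadFiveRecordsSplit02
import Summits.BirchSwinnertonDyer.BirchSwinnertonDyer.Theorems.KatoDescentTamePotSupersingularCartanMuRoadSplitFiveAbelDoors
import HarnessLib

/-!
# Route `KatoDescentTamePotSupersingular` (rung K8, sub-rung B4 (t′), cell `bsd-potss`): per-row (A) and U₀ RE-RECORDS of the three `5Ns` rows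
# 283200dw1, 283200gf1 (THE `p = 5` Conj-A residue row of 19916), 434400l1 WITHOUT Ferrero–Washington and WITHOUT Coates–Sujatha as named facts
# (seat `bsd-potss-k8t-c4` g24; door `CartanMuRoadSplitFiveAbelDoors.{conjA_five,missingUpperBoundAt_five_tame}_of_splitCartanBasis_of_classData`;
# `--supports stmt-BirchSwinnertonDyer-19982 --as helper`)

HONEST FRAMING. THEOREMS ONLY (no definition, no named fact, no `sorry`); PER ROW — NOT a class theorem; nothing is booked; items 19916 / 19202 /
19982 stay OPEN at class level (class-wide open inputs: the zeta crux 24439 and the lower half of the residual 19984); (A), Conjecture A and BSD are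
proved for NO curve here. These are the g17 records `…TameUpperMuRoadFiveRecordsSplit01/02` (kernel lemmas REUSED from there: `Δ ≠ 0`, minimality,
`E[5]` irreducible, `Addv E 5`, `ord₅ j ≥ 0`, `SubTprime E 5`) with the two named facts of the (A)-input GONE: `hCS` (Coates–Sujatha Thm. 3.4) is the
tree theorem `thm34_…_holds` (g22) and `hFW` (Ferrero–Washington) is REPLACED — by the character count of
`Literature/…/ClassicalMuVanishesSplitCartanFiveDescentAbelian` (g24: on `G = N_s(5)` the five linear characters invisible in `ℚ(P₁)`, `L^⟨σ̄_u²σ̄_v⟩`,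
`ℚ(C)` live on three abelian fields) — by DISPLAYED class data of three more leaves of `L = ℚ(E[5])`: `K′ = L^⟨σ̄_uσ̄_v⁻¹, σ̄_w⟩`, `Z = L^⟨σ̄_uσ̄_v⁻¹, σ̄_u²σ̄_w⟩`
(`= L^{ker det} = ℚ(ζ₅)`), `Q₂ = L^⟨σ̄_uσ̄_v⁻¹, σ̄_wσ̄_u⟩`. ROAD: `MissingUpperBoundAt E 5 ⟸` NAMED FACTS Kato's fine-Selmer reading of 14.5 (3) (`hKatoA`),
GZK (`hGZK`), modularity (`hmod`) — NOTHING ELSE — `+` Cremona's `r_an = 0` (`hr`) `+` KERNEL `+` the DISPLAYED split-Cartan basis data (`e`, `he`,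
`σ_u σ_v σ_w` as `diag(2,1)`, `diag(1,2)`, `(0 1;1 0)`; image type `5Ns` = LMFDB's, displayed not certified) `+` CLASS DATA: for each of the five leaves
`ℚ(P₁)` (8), `L^⟨σ̄_u²σ̄_v⟩` (8), `ℚ(C)` (4), `K′` (4), `Z` (4) the two integers «`5 ∤ h`» and «one prime above 5» (Iwasawa 1956, PROVED) and for
`Q₂` (2) ONE rank equality `rank₅ Cl((Q₂)₂) = rank₅ Cl((Q₂)₁)` (Fukuda 1994 Thm. 1 (2), PROVED; total ramification from layer 0 KERNEL). NUMERICS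
(evidence, not kernel): kit j327908 (conjA-anchor g12's engine `unitidx.gp` v2.1 with three extra leaves, sha16 559fc141/22839…; `galoisinit` on the
degree-32 field, fixed fields by `galoisfixedfield`, class numbers CERTIFIED by `bnfcertify`) — IDENTICAL on the three rows: `K′ = x^4 - 5x^2 + 5`
(`= ℚ(ζ₂₀)⁺`, cyclic `C(4)`, quadratic subfield of disc 5) h = 1 CERT, primes above 5 [[4,1]] ⇒ PASS:IW56; `Z = x^4 - x^3 + x^2 - x + 1 ≅ ℚ(ζ₅)`
h = 1 CERT, [[4,1]] ⇒ PASS:IW56; `Q₁ = L^{C_s} = ℚ(√−5)`; **`Q₂ = x^2 + 1 = ℚ(i)`: 5 SPLITS ([[1,1],[1,1]]) ⇒ Iwasawa 1956 VOID, unit index VOID,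
layers (0,1) GROW (e 0→1, r 0→1; `λ₅(ℚ(i)) ≥ 1`, Gold) ⇒ certificate = Fukuda rank stability at layers (1,2): layer 1 = `ℚ(i)·ℚ₁ = x^10+25x^8+140x^6+295x^4+235x^2+49`, h = 5, cyc [5], rank₅ = 1
(CERTIFIED, kit j327926); layer 2 (degree 50): rank₅ = 1 — EXACTLY (no GRH): #A_n = 5ⁿ for n ≤ 3 by the analytic class number formula (j328840: the norms of B_{1,χ₄ψ} are 80, 198288005928058880, … each of 5-valuation 1) and Cl(K_n) ↠ ℤ/5ⁿ by genus theory in the ℤ₅²-extension of ℚ(i), so A_n ≅ ℤ/5ⁿ, rank 1 at layers 1–3 (memo §3); GRH bnfinit of layer 2 (degree 50) = j327926 / j328685, see STATUS (j328840 exact + j327926/j328685 GRH). [A sibling record over conjA-anchor g20's one-layer small-rank criterion —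
rank₅ Cl(K₁) = 1 ≤ 3 alone — is `CartanMuRoadSplitFiveAbelDoorsSmallRank`.]** So on these rows statement (A) at (E,5) now rests on displayed integers and
NO named fact; U₀ on `hKatoA hGZK hmod` only.

References: [Kato2004Asterisque] Thm. 12.5 (3), 14.5 (3); [CoatesSujatha2005] Thm. 3.4; [Fukuda1994] Thm. 1; [Greenberg2001IwasawaPastPresent] Prop. (2.1);
[Washington1997] §7.5, §13.1; [Serre1972] §2.2; [Gold1974]; [Cremona2006] Table 1.
-/

set_option autoImplicit false
set_option linter.dupNamespace false

noncomputable section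

open scoped Classical NumberField Matrix
open WeierstrassCurve Field IntermediateField
  Literature.NumberTheory.EllipticCurves Literature.NumberTheory.EllipticCurves.Rank1Residual
  Literature.NumberTheory.EllipticCurves.Rank1Residual.Typed
  Literature.NumberTheory.GaloisRepresentations Literature.NumberTheory.SerreUniformity
  Literature.NumberTheory.IwasawaTheory
  Summit.BirchSwinnertonDyer.Rank1Residual Summit.BirchSwinnertonDyer.Rank1Residual.Additive
  Summit.BirchSwinnertonDyer.BirchSwinnertonDyer.Theorems

namespace Summit.BirchSwinnertonDyer.BirchSwinnertonDyer.Theorems.TameConjAFiveRecords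

/-! ### `283200dw1` @ `p = 5` — ♭ row (`5 ∤ ∏ c_ℓ`); image `5Ns` (#G 32); leaf class data (kit j327908, CERTIFIED): P<v> `x^8 + 20*x^4 - 40*x^2 + 20` h = 4, primes above 5 [[8,1]];
Dq<u^2 v> `x^8 + 20*x^4 + 40*x^2 + 20` h = 4, [[8,1]]; C<uv,w> `x^4 - x^2 - 1` h = 1, [[2,2]]; K′<uv⁻¹,w> `x^4 - 5x^2 + 5` h = 1, [[4,1]]; Z<uv⁻¹,u²w> `x^4 - x^3 + x^2 - x + 1`
(≅ ℚ(ζ₅)) h = 1, [[4,1]] — all PASS:IW56; Q₂<uv⁻¹,wu> `x^2 + 1` (ℚ(i), 5 split): rank₅ Cl at layers (1,2) = 1, 1 (rank₅ Cl at layers 1, 2 = 1, 1: j327926 layer 1 CERT; layer 2 by j328840's exact class-number formula + genus theory, memo §3). -/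

/-- **(A) at `(283200dw1, 5)` — the conclusion of `TameCoatesSujathaResidue` (19916) AT THIS ROW — with NO named fact**: for every cyclotomic
`ℤ_5`-extension `κ` of `ℚ`, the dual fine Selmer group of `E` over `ℚ_cyc` is finitely generated over `ℤ_5`, from the KERNEL irreducibility of `E[5]`,
the DISPLAYED split-Cartan basis data and the DISPLAYED class data of the six leaves (five Iwasawa-1956 certificates `hh* hv*`, one Fukuda rank equality
`hrkQ` at layers (1,2) for `Q₂ = ℚ(i)`); door `CartanMuRoadSplitFiveAbelDoors.conjA_five_of_splitCartanBasis_of_classData` (Coates–Sujatha 3.4, Iwasawa 1956 and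
Fukuda (2) all PROVED in the tree; Ferrero–Washington not used). CONDITIONAL record; (A) is asserted for no curve; nothing booked.
[cite: CoatesSujatha2005, Thm. 3.4 (§3)] [cite: Greenberg2001IwasawaPastPresent, Prop. (2.1) (p. 339)] [cite: Fukuda1994, Thm. 1 (2), p. 264]
[cite: Serre1972, §2.2] [cite: Cremona2006, Table 1 (Cremona label 283200dw1)] -/
theorem conjA_g283200dw1_5_abel
    {W : WeierstrassCurve ℚ} [W.IsElliptic] (hWeq : W = (⟨0, (-1), 0, 194792, 94585162⟩ : WeierstrassCurve ℚ))
    (e : W.geomTorsion (5 : ℕ) ≃+ (Fin 2 → ZMod 5))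
    (he : ∀ σ : absoluteGaloisGroup ℚ, ∃ M ∈ splitCartanNormalizer 5, ∀ P : W.geomTorsion (5 : ℕ), e (σ • P) = M *ᵥ e P)
    (σu σv σw : absoluteGaloisGroup ℚ) (hσu : ∀ P : W.geomTorsion (5 : ℕ), e (σu • P) = !![2, 0; 0, 1] *ᵥ e P)
    (hσv : ∀ P : W.geomTorsion (5 : ℕ), e (σv • P) = !![1, 0; 0, 2] *ᵥ e P)
    (hσw : ∀ P : W.geomTorsion (5 : ℕ), e (σw • P) = !![0, 1; 1, 0] *ᵥ e P)
    (hhP : haveI : NumberField ↥(W.divisionField 5) := NumberField.mk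
      ¬ 5 ∣ NumberField.classNumber ↥(fixedField (Subgroup.zpowers (absRestrictNormalHom (W.divisionField 5) σv))))
    (hvP : haveI : NumberField ↥(W.divisionField 5) := NumberField.mk
      ∃! v : IsDedekindDomain.HeightOneSpectrum (𝓞 ↥(fixedField (Subgroup.zpowers (absRestrictNormalHom (W.divisionField 5) σv)))),
        ((5 : ℕ) : 𝓞 ↥(fixedField (Subgroup.zpowers (absRestrictNormalHom (W.divisionField 5) σv)))) ∈ v.asIdeal)
    (hhD : haveI : NumberField ↥(W.divisionField 5) := NumberField.mk
      ¬ 5 ∣ NumberField.classNumber ↥(fixedField (Subgroup.zpowers (absRestrictNormalHom (W.divisionField 5) σu *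
        absRestrictNormalHom (W.divisionField 5) σu * absRestrictNormalHom (W.divisionField 5) σv))))
    (hvD : haveI : NumberField ↥(W.divisionField 5) := NumberField.mk
      ∃! v : IsDedekindDomain.HeightOneSpectrum (𝓞 ↥(fixedField (Subgroup.zpowers (absRestrictNormalHom (W.divisionField 5) σu *
        absRestrictNormalHom (W.divisionField 5) σu * absRestrictNormalHom (W.divisionField 5) σv)))),
        ((5 : ℕ) : 𝓞 ↥(fixedField (Subgroup.zpowers (absRestrictNormalHom (W.divisionField 5) σu *
        absRestrictNormalHom (W.divisionField 5) σu * absRestrictNormalHom (W.divisionField 5) σv)))) ∈ v.asIdeal)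
    (hhC : haveI : NumberField ↥(W.divisionField 5) := NumberField.mk
      ¬ 5 ∣ NumberField.classNumber ↥(fixedField (Subgroup.zpowers (absRestrictNormalHom (W.divisionField 5) σu *
        absRestrictNormalHom (W.divisionField 5) σv) ⊔ Subgroup.zpowers (absRestrictNormalHom (W.divisionField 5) σw))))
    (hvC : haveI : NumberField ↥(W.divisionField 5) := NumberField.mk
      ∃! v : IsDedekindDomain.HeightOneSpectrum (𝓞 ↥(fixedField (Subgroup.zpowers (absRestrictNormalHom (W.divisionField 5) σu *
        absRestrictNormalHom (W.divisionField 5) σv) ⊔ Subgroup.zpowers (absRestrictNormalHom (W.divisionField 5) σw)))),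
        ((5 : ℕ) : 𝓞 ↥(fixedField (Subgroup.zpowers (absRestrictNormalHom (W.divisionField 5) σu *
        absRestrictNormalHom (W.divisionField 5) σv) ⊔ Subgroup.zpowers (absRestrictNormalHom (W.divisionField 5) σw)))) ∈ v.asIdeal)
    (hhK : haveI : NumberField ↥(W.divisionField 5) := NumberField.mk
      ¬ 5 ∣ NumberField.classNumber ↥(fixedField (Subgroup.zpowers (absRestrictNormalHom (W.divisionField 5) σu *
        (absRestrictNormalHom (W.divisionField 5) σv)⁻¹) ⊔ Subgroup.zpowers (absRestrictNormalHom (W.divisionField 5) σw))))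
    (hvK : haveI : NumberField ↥(W.divisionField 5) := NumberField.mk
      ∃! v : IsDedekindDomain.HeightOneSpectrum (𝓞 ↥(fixedField (Subgroup.zpowers (absRestrictNormalHom (W.divisionField 5) σu *
        (absRestrictNormalHom (W.divisionField 5) σv)⁻¹) ⊔ Subgroup.zpowers (absRestrictNormalHom (W.divisionField 5) σw)))),
        ((5 : ℕ) : 𝓞 ↥(fixedField (Subgroup.zpowers (absRestrictNormalHom (W.divisionField 5) σu *
        (absRestrictNormalHom (W.divisionField 5) σv)⁻¹) ⊔ Subgroup.zpowers (absRestrictNormalHom (W.divisionField 5) σw)))) ∈ v.asIdeal)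
    (hhZ : haveI : NumberField ↥(W.divisionField 5) := NumberField.mk
      ¬ 5 ∣ NumberField.classNumber ↥(fixedField (Subgroup.zpowers (absRestrictNormalHom (W.divisionField 5) σu *
        (absRestrictNormalHom (W.divisionField 5) σv)⁻¹) ⊔ Subgroup.zpowers (absRestrictNormalHom (W.divisionField 5) σu *
        absRestrictNormalHom (W.divisionField 5) σu * absRestrictNormalHom (W.divisionField 5) σw))))
    (hvZ : haveI : NumberField ↥(W.divisionField 5) := NumberField.mk
      ∃! v : IsDedekindDomain.HeightOneSpectrum (𝓞 ↥(fixedField (Subgroup.zpowers (absRestrictNormalHom (W.divisionField 5) σu *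
        (absRestrictNormalHom (W.divisionField 5) σv)⁻¹) ⊔ Subgroup.zpowers (absRestrictNormalHom (W.divisionField 5) σu *
        absRestrictNormalHom (W.divisionField 5) σu * absRestrictNormalHom (W.divisionField 5) σw)))),
        ((5 : ℕ) : 𝓞 ↥(fixedField (Subgroup.zpowers (absRestrictNormalHom (W.divisionField 5) σu *
        (absRestrictNormalHom (W.divisionField 5) σv)⁻¹) ⊔ Subgroup.zpowers (absRestrictNormalHom (W.divisionField 5) σu *
        absRestrictNormalHom (W.divisionField 5) σu * absRestrictNormalHom (W.divisionField 5) σw)))) ∈ v.asIdeal)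
    (hrkQ : haveI : NumberField ↥(W.divisionField 5) := NumberField.mk
      ∀ κE : ZpExtension ↥(fixedField (Subgroup.zpowers (absRestrictNormalHom (W.divisionField 5) σu *
        (absRestrictNormalHom (W.divisionField 5) σv)⁻¹) ⊔ Subgroup.zpowers (absRestrictNormalHom (W.divisionField 5) σw *
        absRestrictNormalHom (W.divisionField 5) σu))) 5,
        κE.IsCyclotomic → classGroupPRank κE (1 + 1) = classGroupPRank κE 1)
    (κ : ZpExtension ℚ 5) (hκ : κ.IsCyclotomic) :
    ∃ (γ : absoluteGaloisGroup ℚ) (Df : W.FineSelmerDualData κ γ),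
      Module.Finite ℤ_[5] (RestrictScalars ℤ_[5] (IwasawaAlgebra 5) Df.X) := by
  subst hWeq
  haveI : Fact (Nat.Prime 5) := ⟨by norm_num⟩
  exact CartanMuRoadSplitFiveAbelDoors.conjA_five_of_splitCartanBasis_of_classData _ irr_g283200dw1_5 e he σu σv σw hσu hσv hσw
    hhP hvP hhD hvD hhC hvC hhK hvK hhZ hvZ 1 hrkQ κ hκ

/-- **RE-RECORD — UPPER half `ord₅ #Ш(E) ≤ ord₅ #Ш(E)_an` for `E = 283200dw1` at `p = 5` BY THE μ-ROAD, modulo `hKatoA hGZK hmod` ONLY** (U₀-ns row of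
KT items 19202 / 19982): the (t′) door `CartanMuRoadSplitFiveAbelDoors.missingUpperBoundAt_five_tame_of_splitCartanBasis_of_classData` (fine-Selmer port of
Kato 14.5 (3) ∘ (A) from class data). KERNEL (g17's file): `Δ ≠ 0`, global minimality, `E[5]` irreducible, `Addv E 5`, `SubTprime E 5`. DISPLAYED: the named
facts `hKatoA hGZK hmod`; Cremona's `r_an = 0` (`hr`); the split-Cartan basis data and the class data of `conjA_g283200dw1_5_abel`. Compared with g17's
`missingUpperBoundAt_g283200dw1_5`: `hCS` and `hFW` are GONE. Per row; CONDITIONAL; nothing booked; BSD is not proved by this.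
[cite: Kato2004Asterisque, Thm. 14.5 (3) (p. 236), Thm. 12.5 (3) (p. 222)] [cite: CoatesSujatha2005, Thm. 3.4 (§3)] [cite: Fukuda1994, Thm. 1 (2), p. 264]
[cite: Miller2011LMS, Def. 1.1] [cite: Cremona2006, Table 1 (Cremona label 283200dw1)] -/
theorem missingUpperBoundAt_g283200dw1_5_abel
    (hKatoA : Kato2004.rankZero_padicValNat_sha_add_padicValNat_tamagawa_le_of_additive_potGood_of_irreducible_of_fineSelmerDual_fg)
    (hGZK : rank_eq_analyticRank_of_analyticRank_le_one) (hmod : hasEntireLFunction_rat)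
    {W : WeierstrassCurve ℚ} [W.IsElliptic] [W.IsGloballyMinimal] (hWeq : W = (⟨0, (-1), 0, 194792, 94585162⟩ : WeierstrassCurve ℚ)) (hr : W.analyticRank = 0)
    (e : W.geomTorsion (5 : ℕ) ≃+ (Fin 2 → ZMod 5))
    (he : ∀ σ : absoluteGaloisGroup ℚ, ∃ M ∈ splitCartanNormalizer 5, ∀ P : W.geomTorsion (5 : ℕ), e (σ • P) = M *ᵥ e P)
    (σu σv σw : absoluteGaloisGroup ℚ) (hσu : ∀ P : W.geomTorsion (5 : ℕ), e (σu • P) = !![2, 0; 0, 1] *ᵥ e P)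
    (hσv : ∀ P : W.geomTorsion (5 : ℕ), e (σv • P) = !![1, 0; 0, 2] *ᵥ e P)
    (hσw : ∀ P : W.geomTorsion (5 : ℕ), e (σw • P) = !![0, 1; 1, 0] *ᵥ e P)
    (hhP : haveI : NumberField ↥(W.divisionField 5) := NumberField.mk
      ¬ 5 ∣ NumberField.classNumber ↥(fixedField (Subgroup.zpowers (absRestrictNormalHom (W.divisionField 5) σv))))
    (hvP : haveI : NumberField ↥(W.divisionField 5) := NumberField.mk
      ∃! v : IsDedekindDomain.HeightOneSpectrum (𝓞 ↥(fixedField (Subgroup.zpowers (absRestrictNormalHom (W.divisionField 5) σv)))),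
        ((5 : ℕ) : 𝓞 ↥(fixedField (Subgroup.zpowers (absRestrictNormalHom (W.divisionField 5) σv)))) ∈ v.asIdeal)
    (hhD : haveI : NumberField ↥(W.divisionField 5) := NumberField.mk
      ¬ 5 ∣ NumberField.classNumber ↥(fixedField (Subgroup.zpowers (absRestrictNormalHom (W.divisionField 5) σu *
        absRestrictNormalHom (W.divisionField 5) σu * absRestrictNormalHom (W.divisionField 5) σv))))
    (hvD : haveI : NumberField ↥(W.divisionField 5) := NumberField.mk
      ∃! v : IsDedekindDomain.HeightOneSpectrum (𝓞 ↥(fixedField (Subgroup.zpowers (absRestrictNormalHom (W.divisionField 5) σu *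
        absRestrictNormalHom (W.divisionField 5) σu * absRestrictNormalHom (W.divisionField 5) σv)))),
        ((5 : ℕ) : 𝓞 ↥(fixedField (Subgroup.zpowers (absRestrictNormalHom (W.divisionField 5) σu *
        absRestrictNormalHom (W.divisionField 5) σu * absRestrictNormalHom (W.divisionField 5) σv)))) ∈ v.asIdeal)
    (hhC : haveI : NumberField ↥(W.divisionField 5) := NumberField.mk
      ¬ 5 ∣ NumberField.classNumber ↥(fixedField (Subgroup.zpowers (absRestrictNormalHom (W.divisionField 5) σu *
        absRestrictNormalHom (W.divisionField 5) σv) ⊔ Subgroup.zpowers (absRestrictNormalHom (W.divisionField 5) σw))))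
    (hvC : haveI : NumberField ↥(W.divisionField 5) := NumberField.mk
      ∃! v : IsDedekindDomain.HeightOneSpectrum (𝓞 ↥(fixedField (Subgroup.zpowers (absRestrictNormalHom (W.divisionField 5) σu *
        absRestrictNormalHom (W.divisionField 5) σv) ⊔ Subgroup.zpowers (absRestrictNormalHom (W.divisionField 5) σw)))),
        ((5 : ℕ) : 𝓞 ↥(fixedField (Subgroup.zpowers (absRestrictNormalHom (W.divisionField 5) σu *
        absRestrictNormalHom (W.divisionField 5) σv) ⊔ Subgroup.zpowers (absRestrictNormalHom (W.divisionField 5) σw)))) ∈ v.asIdeal)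
    (hhK : haveI : NumberField ↥(W.divisionField 5) := NumberField.mk
      ¬ 5 ∣ NumberField.classNumber ↥(fixedField (Subgroup.zpowers (absRestrictNormalHom (W.divisionField 5) σu *
        (absRestrictNormalHom (W.divisionField 5) σv)⁻¹) ⊔ Subgroup.zpowers (absRestrictNormalHom (W.divisionField 5) σw))))
    (hvK : haveI : NumberField ↥(W.divisionField 5) := NumberField.mk
      ∃! v : IsDedekindDomain.HeightOneSpectrum (𝓞 ↥(fixedField (Subgroup.zpowers (absRestrictNormalHom (W.divisionField 5) σu *
        (absRestrictNormalHom (W.divisionField 5) σv)⁻¹) ⊔ Subgroup.zpowers (absRestrictNormalHom (W.divisionField 5) σw)))),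
        ((5 : ℕ) : 𝓞 ↥(fixedField (Subgroup.zpowers (absRestrictNormalHom (W.divisionField 5) σu *
        (absRestrictNormalHom (W.divisionField 5) σv)⁻¹) ⊔ Subgroup.zpowers (absRestrictNormalHom (W.divisionField 5) σw)))) ∈ v.asIdeal)
    (hhZ : haveI : NumberField ↥(W.divisionField 5) := NumberField.mk
      ¬ 5 ∣ NumberField.classNumber ↥(fixedField (Subgroup.zpowers (absRestrictNormalHom (W.divisionField 5) σu *
        (absRestrictNormalHom (W.divisionField 5) σv)⁻¹) ⊔ Subgroup.zpowers (absRestrictNormalHom (W.divisionField 5) σu *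
        absRestrictNormalHom (W.divisionField 5) σu * absRestrictNormalHom (W.divisionField 5) σw))))
    (hvZ : haveI : NumberField ↥(W.divisionField 5) := NumberField.mk
      ∃! v : IsDedekindDomain.HeightOneSpectrum (𝓞 ↥(fixedField (Subgroup.zpowers (absRestrictNormalHom (W.divisionField 5) σu *
        (absRestrictNormalHom (W.divisionField 5) σv)⁻¹) ⊔ Subgroup.zpowers (absRestrictNormalHom (W.divisionField 5) σu *
        absRestrictNormalHom (W.divisionField 5) σu * absRestrictNormalHom (W.divisionField 5) σw)))),
        ((5 : ℕ) : 𝓞 ↥(fixedField (Subgroup.zpowers (absRestrictNormalHom (W.divisionField 5) σu *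
        (absRestrictNormalHom (W.divisionField 5) σv)⁻¹) ⊔ Subgroup.zpowers (absRestrictNormalHom (W.divisionField 5) σu *
        absRestrictNormalHom (W.divisionField 5) σu * absRestrictNormalHom (W.divisionField 5) σw)))) ∈ v.asIdeal)
    (hrkQ : haveI : NumberField ↥(W.divisionField 5) := NumberField.mk
      ∀ κE : ZpExtension ↥(fixedField (Subgroup.zpowers (absRestrictNormalHom (W.divisionField 5) σu *
        (absRestrictNormalHom (W.divisionField 5) σv)⁻¹) ⊔ Subgroup.zpowers (absRestrictNormalHom (W.divisionField 5) σw *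
        absRestrictNormalHom (W.divisionField 5) σu))) 5,
        κE.IsCyclotomic → classGroupPRank κE (1 + 1) = classGroupPRank κE 1) :
    MissingUpperBoundAt W 5 := by
  subst hWeq
  haveI : Fact (Nat.Prime 5) := ⟨by norm_num⟩
  exact CartanMuRoadSplitFiveAbelDoors.missingUpperBoundAt_five_tame_of_splitCartanBasis_of_classData _ hKatoA hGZK hmod hr
    addv_g283200dw1_5 subTprime_g283200dw1_5 irr_g283200dw1_5 e he σu σv σw hσu hσv hσw hhP hvP hhD hvD hhC hvC hhK hvK hhZ hvZ 1 hrkQ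

/-! ### `283200gf1` @ `p = 5` — ♯ row with TWO Tamagawa carriers: THE `p = 5` Conj-A RESIDUE row of 19916 (no unit-twist road); image `5Ns` (#G 32); leaf class data (kit j327908, CERTIFIED): P<v> `x^8 + 20*x^4 + 40*x^2 + 20` h = 4, primes above 5 [[8,1]];
Dq<u^2 v> `x^8 + 20*x^4 - 40*x^2 + 20` h = 4, [[8,1]]; C<uv,w> `x^4 - x^2 - 1` h = 1, [[2,2]]; K′<uv⁻¹,w> `x^4 - 5x^2 + 5` h = 1, [[4,1]]; Z<uv⁻¹,u²w> `x^4 - x^3 + x^2 - x + 1`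
(≅ ℚ(ζ₅)) h = 1, [[4,1]] — all PASS:IW56; Q₂<uv⁻¹,wu> `x^2 + 1` (ℚ(i), 5 split): rank₅ Cl at layers (1,2) = 1, 1 (rank₅ Cl at layers 1, 2 = 1, 1: j327926 layer 1 CERT; layer 2 by j328840's exact class-number formula + genus theory, memo §3). -/

/-- **(A) at `(283200gf1, 5)` — the conclusion of `TameCoatesSujathaResidue` (19916) AT THIS ROW — with NO named fact**: for every cyclotomic
`ℤ_5`-extension `κ` of `ℚ`, the dual fine Selmer group of `E` over `ℚ_cyc` is finitely generated over `ℤ_5`, from the KERNEL irreducibility of `E[5]`,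
the DISPLAYED split-Cartan basis data and the DISPLAYED class data of the six leaves (five Iwasawa-1956 certificates `hh* hv*`, one Fukuda rank equality
`hrkQ` at layers (1,2) for `Q₂ = ℚ(i)`); door `CartanMuRoadSplitFiveAbelDoors.conjA_five_of_splitCartanBasis_of_classData` (Coates–Sujatha 3.4, Iwasawa 1956 and
Fukuda (2) all PROVED in the tree; Ferrero–Washington not used). CONDITIONAL record; (A) is asserted for no curve; nothing booked.
[cite: CoatesSujatha2005, Thm. 3.4 (§3)] [cite: Greenberg2001IwasawaPastPresent, Prop. (2.1) (p. 339)] [cite: Fukuda1994, Thm. 1 (2), p. 264]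
[cite: Serre1972, §2.2] [cite: Cremona2006, Table 1 (Cremona label 283200gf1)] -/
theorem conjA_g283200gf1_5_abel
    {W : WeierstrassCurve ℚ} [W.IsElliptic] (hWeq : W = (⟨0, 1, 0, 194792, (-94585162)⟩ : WeierstrassCurve ℚ))
    (e : W.geomTorsion (5 : ℕ) ≃+ (Fin 2 → ZMod 5))
    (he : ∀ σ : absoluteGaloisGroup ℚ, ∃ M ∈ splitCartanNormalizer 5, ∀ P : W.geomTorsion (5 : ℕ), e (σ • P) = M *ᵥ e P)
    (σu σv σw : absoluteGaloisGroup ℚ) (hσu : ∀ P : W.geomTorsion (5 : ℕ), e (σu • P) = !![2, 0; 0, 1] *ᵥ e P)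
    (hσv : ∀ P : W.geomTorsion (5 : ℕ), e (σv • P) = !![1, 0; 0, 2] *ᵥ e P)
    (hσw : ∀ P : W.geomTorsion (5 : ℕ), e (σw • P) = !![0, 1; 1, 0] *ᵥ e P)
    (hhP : haveI : NumberField ↥(W.divisionField 5) := NumberField.mk
      ¬ 5 ∣ NumberField.classNumber ↥(fixedField (Subgroup.zpowers (absRestrictNormalHom (W.divisionField 5) σv))))
    (hvP : haveI : NumberField ↥(W.divisionField 5) := NumberField.mk
      ∃! v : IsDedekindDomain.HeightOneSpectrum (𝓞 ↥(fixedField (Subgroup.zpowers (absRestrictNormalHom (W.divisionField 5) σv)))),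
        ((5 : ℕ) : 𝓞 ↥(fixedField (Subgroup.zpowers (absRestrictNormalHom (W.divisionField 5) σv)))) ∈ v.asIdeal)
    (hhD : haveI : NumberField ↥(W.divisionField 5) := NumberField.mk
      ¬ 5 ∣ NumberField.classNumber ↥(fixedField (Subgroup.zpowers (absRestrictNormalHom (W.divisionField 5) σu *
        absRestrictNormalHom (W.divisionField 5) σu * absRestrictNormalHom (W.divisionField 5) σv))))
    (hvD : haveI : NumberField ↥(W.divisionField 5) := NumberField.mk
      ∃! v : IsDedekindDomain.HeightOneSpectrum (𝓞 ↥(fixedField (Subgroup.zpowers (absRestrictNormalHom (W.divisionField 5) σu *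
        absRestrictNormalHom (W.divisionField 5) σu * absRestrictNormalHom (W.divisionField 5) σv)))),
        ((5 : ℕ) : 𝓞 ↥(fixedField (Subgroup.zpowers (absRestrictNormalHom (W.divisionField 5) σu *
        absRestrictNormalHom (W.divisionField 5) σu * absRestrictNormalHom (W.divisionField 5) σv)))) ∈ v.asIdeal)
    (hhC : haveI : NumberField ↥(W.divisionField 5) := NumberField.mk
      ¬ 5 ∣ NumberField.classNumber ↥(fixedField (Subgroup.zpowers (absRestrictNormalHom (W.divisionField 5) σu *
        absRestrictNormalHom (W.divisionField 5) σv) ⊔ Subgroup.zpowers (absRestrictNormalHom (W.divisionField 5) σw))))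
    (hvC : haveI : NumberField ↥(W.divisionField 5) := NumberField.mk
      ∃! v : IsDedekindDomain.HeightOneSpectrum (𝓞 ↥(fixedField (Subgroup.zpowers (absRestrictNormalHom (W.divisionField 5) σu *
        absRestrictNormalHom (W.divisionField 5) σv) ⊔ Subgroup.zpowers (absRestrictNormalHom (W.divisionField 5) σw)))),
        ((5 : ℕ) : 𝓞 ↥(fixedField (Subgroup.zpowers (absRestrictNormalHom (W.divisionField 5) σu *
        absRestrictNormalHom (W.divisionField 5) σv) ⊔ Subgroup.zpowers (absRestrictNormalHom (W.divisionField 5) σw)))) ∈ v.asIdeal)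
    (hhK : haveI : NumberField ↥(W.divisionField 5) := NumberField.mk
      ¬ 5 ∣ NumberField.classNumber ↥(fixedField (Subgroup.zpowers (absRestrictNormalHom (W.divisionField 5) σu *
        (absRestrictNormalHom (W.divisionField 5) σv)⁻¹) ⊔ Subgroup.zpowers (absRestrictNormalHom (W.divisionField 5) σw))))
    (hvK : haveI : NumberField ↥(W.divisionField 5) := NumberField.mk
      ∃! v : IsDedekindDomain.HeightOneSpectrum (𝓞 ↥(fixedField (Subgroup.zpowers (absRestrictNormalHom (W.divisionField 5) σu *
        (absRestrictNormalHom (W.divisionField 5) σv)⁻¹) ⊔ Subgroup.zpowers (absRestrictNormalHom (W.divisionField 5) σw)))),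
        ((5 : ℕ) : 𝓞 ↥(fixedField (Subgroup.zpowers (absRestrictNormalHom (W.divisionField 5) σu *
        (absRestrictNormalHom (W.divisionField 5) σv)⁻¹) ⊔ Subgroup.zpowers (absRestrictNormalHom (W.divisionField 5) σw)))) ∈ v.asIdeal)
    (hhZ : haveI : NumberField ↥(W.divisionField 5) := NumberField.mk
      ¬ 5 ∣ NumberField.classNumber ↥(fixedField (Subgroup.zpowers (absRestrictNormalHom (W.divisionField 5) σu *
        (absRestrictNormalHom (W.divisionField 5) σv)⁻¹) ⊔ Subgroup.zpowers (absRestrictNormalHom (W.divisionField 5) σu *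
        absRestrictNormalHom (W.divisionField 5) σu * absRestrictNormalHom (W.divisionField 5) σw))))
    (hvZ : haveI : NumberField ↥(W.divisionField 5) := NumberField.mk
      ∃! v : IsDedekindDomain.HeightOneSpectrum (𝓞 ↥(fixedField (Subgroup.zpowers (absRestrictNormalHom (W.divisionField 5) σu *
        (absRestrictNormalHom (W.divisionField 5) σv)⁻¹) ⊔ Subgroup.zpowers (absRestrictNormalHom (W.divisionField 5) σu *
        absRestrictNormalHom (W.divisionField 5) σu * absRestrictNormalHom (W.divisionField 5) σw)))),
        ((5 : ℕ) : 𝓞 ↥(fixedField (Subgroup.zpowers (absRestrictNormalHom (W.divisionField 5) σu *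
        (absRestrictNormalHom (W.divisionField 5) σv)⁻¹) ⊔ Subgroup.zpowers (absRestrictNormalHom (W.divisionField 5) σu *
        absRestrictNormalHom (W.divisionField 5) σu * absRestrictNormalHom (W.divisionField 5) σw)))) ∈ v.asIdeal)
    (hrkQ : haveI : NumberField ↥(W.divisionField 5) := NumberField.mk
      ∀ κE : ZpExtension ↥(fixedField (Subgroup.zpowers (absRestrictNormalHom (W.divisionField 5) σu *
        (absRestrictNormalHom (W.divisionField 5) σv)⁻¹) ⊔ Subgroup.zpowers (absRestrictNormalHom (W.divisionField 5) σw *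
        absRestrictNormalHom (W.divisionField 5) σu))) 5,
        κE.IsCyclotomic → classGroupPRank κE (1 + 1) = classGroupPRank κE 1)
    (κ : ZpExtension ℚ 5) (hκ : κ.IsCyclotomic) :
    ∃ (γ : absoluteGaloisGroup ℚ) (Df : W.FineSelmerDualData κ γ),
      Module.Finite ℤ_[5] (RestrictScalars ℤ_[5] (IwasawaAlgebra 5) Df.X) := by
  subst hWeq
  haveI : Fact (Nat.Prime 5) := ⟨by norm_num⟩
  exact CartanMuRoadSplitFiveAbelDoors.conjA_five_of_splitCartanBasis_of_classData _ irr_g283200gf1_5 e he σu σv σw hσu hσv hσw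
    hhP hvP hhD hvD hhC hvC hhK hvK hhZ hvZ 1 hrkQ κ hκ

/-- **RE-RECORD — UPPER half `ord₅ #Ш(E) ≤ ord₅ #Ш(E)_an` for `E = 283200gf1` at `p = 5` BY THE μ-ROAD, modulo `hKatoA hGZK hmod` ONLY** (U₀-ns row of
KT items 19202 / 19982): the (t′) door `CartanMuRoadSplitFiveAbelDoors.missingUpperBoundAt_five_tame_of_splitCartanBasis_of_classData` (fine-Selmer port of
Kato 14.5 (3) ∘ (A) from class data). KERNEL (g17's file): `Δ ≠ 0`, global minimality, `E[5]` irreducible, `Addv E 5`, `SubTprime E 5`. DISPLAYED: the named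
facts `hKatoA hGZK hmod`; Cremona's `r_an = 0` (`hr`); the split-Cartan basis data and the class data of `conjA_g283200gf1_5_abel`. Compared with g17's
`missingUpperBoundAt_g283200gf1_5`: `hCS` and `hFW` are GONE. Per row; CONDITIONAL; nothing booked; BSD is not proved by this.
[cite: Kato2004Asterisque, Thm. 14.5 (3) (p. 236), Thm. 12.5 (3) (p. 222)] [cite: CoatesSujatha2005, Thm. 3.4 (§3)] [cite: Fukuda1994, Thm. 1 (2), p. 264]
[cite: Miller2011LMS, Def. 1.1] [cite: Cremona2006, Table 1 (Cremona label 283200gf1)] -/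
theorem missingUpperBoundAt_g283200gf1_5_abel
    (hKatoA : Kato2004.rankZero_padicValNat_sha_add_padicValNat_tamagawa_le_of_additive_potGood_of_irreducible_of_fineSelmerDual_fg)
    (hGZK : rank_eq_analyticRank_of_analyticRank_le_one) (hmod : hasEntireLFunction_rat)
    {W : WeierstrassCurve ℚ} [W.IsElliptic] [W.IsGloballyMinimal] (hWeq : W = (⟨0, 1, 0, 194792, (-94585162)⟩ : WeierstrassCurve ℚ)) (hr : W.analyticRank = 0)
    (e : W.geomTorsion (5 : ℕ) ≃+ (Fin 2 → ZMod 5))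
    (he : ∀ σ : absoluteGaloisGroup ℚ, ∃ M ∈ splitCartanNormalizer 5, ∀ P : W.geomTorsion (5 : ℕ), e (σ • P) = M *ᵥ e P)
    (σu σv σw : absoluteGaloisGroup ℚ) (hσu : ∀ P : W.geomTorsion (5 : ℕ), e (σu • P) = !![2, 0; 0, 1] *ᵥ e P)
    (hσv : ∀ P : W.geomTorsion (5 : ℕ), e (σv • P) = !![1, 0; 0, 2] *ᵥ e P)
    (hσw : ∀ P : W.geomTorsion (5 : ℕ), e (σw • P) = !![0, 1; 1, 0] *ᵥ e P)
    (hhP : haveI : NumberField ↥(W.divisionField 5) := NumberField.mk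
      ¬ 5 ∣ NumberField.classNumber ↥(fixedField (Subgroup.zpowers (absRestrictNormalHom (W.divisionField 5) σv))))
    (hvP : haveI : NumberField ↥(W.divisionField 5) := NumberField.mk
      ∃! v : IsDedekindDomain.HeightOneSpectrum (𝓞 ↥(fixedField (Subgroup.zpowers (absRestrictNormalHom (W.divisionField 5) σv)))),
        ((5 : ℕ) : 𝓞 ↥(fixedField (Subgroup.zpowers (absRestrictNormalHom (W.divisionField 5) σv)))) ∈ v.asIdeal)
    (hhD : haveI : NumberField ↥(W.divisionField 5) := NumberField.mk
      ¬ 5 ∣ NumberField.classNumber ↥(fixedField (Subgroup.zpowers (absRestrictNormalHom (W.divisionField 5) σu *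
        absRestrictNormalHom (W.divisionField 5) σu * absRestrictNormalHom (W.divisionField 5) σv))))
    (hvD : haveI : NumberField ↥(W.divisionField 5) := NumberField.mk
      ∃! v : IsDedekindDomain.HeightOneSpectrum (𝓞 ↥(fixedField (Subgroup.zpowers (absRestrictNormalHom (W.divisionField 5) σu *
        absRestrictNormalHom (W.divisionField 5) σu * absRestrictNormalHom (W.divisionField 5) σv)))),
        ((5 : ℕ) : 𝓞 ↥(fixedField (Subgroup.zpowers (absRestrictNormalHom (W.divisionField 5) σu *
        absRestrictNormalHom (W.divisionField 5) σu * absRestrictNormalHom (W.divisionField 5) σv)))) ∈ v.asIdeal)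
    (hhC : haveI : NumberField ↥(W.divisionField 5) := NumberField.mk
      ¬ 5 ∣ NumberField.classNumber ↥(fixedField (Subgroup.zpowers (absRestrictNormalHom (W.divisionField 5) σu *
        absRestrictNormalHom (W.divisionField 5) σv) ⊔ Subgroup.zpowers (absRestrictNormalHom (W.divisionField 5) σw))))
    (hvC : haveI : NumberField ↥(W.divisionField 5) := NumberField.mk
      ∃! v : IsDedekindDomain.HeightOneSpectrum (𝓞 ↥(fixedField (Subgroup.zpowers (absRestrictNormalHom (W.divisionField 5) σu *
        absRestrictNormalHom (W.divisionField 5) σv) ⊔ Subgroup.zpowers (absRestrictNormalHom (W.divisionField 5) σw)))),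
        ((5 : ℕ) : 𝓞 ↥(fixedField (Subgroup.zpowers (absRestrictNormalHom (W.divisionField 5) σu *
        absRestrictNormalHom (W.divisionField 5) σv) ⊔ Subgroup.zpowers (absRestrictNormalHom (W.divisionField 5) σw)))) ∈ v.asIdeal)
    (hhK : haveI : NumberField ↥(W.divisionField 5) := NumberField.mk
      ¬ 5 ∣ NumberField.classNumber ↥(fixedField (Subgroup.zpowers (absRestrictNormalHom (W.divisionField 5) σu *
        (absRestrictNormalHom (W.divisionField 5) σv)⁻¹) ⊔ Subgroup.zpowers (absRestrictNormalHom (W.divisionField 5) σw))))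
    (hvK : haveI : NumberField ↥(W.divisionField 5) := NumberField.mk
      ∃! v : IsDedekindDomain.HeightOneSpectrum (𝓞 ↥(fixedField (Subgroup.zpowers (absRestrictNormalHom (W.divisionField 5) σu *
        (absRestrictNormalHom (W.divisionField 5) σv)⁻¹) ⊔ Subgroup.zpowers (absRestrictNormalHom (W.divisionField 5) σw)))),
        ((5 : ℕ) : 𝓞 ↥(fixedField (Subgroup.zpowers (absRestrictNormalHom (W.divisionField 5) σu *
        (absRestrictNormalHom (W.divisionField 5) σv)⁻¹) ⊔ Subgroup.zpowers (absRestrictNormalHom (W.divisionField 5) σw)))) ∈ v.asIdeal)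
    (hhZ : haveI : NumberField ↥(W.divisionField 5) := NumberField.mk
      ¬ 5 ∣ NumberField.classNumber ↥(fixedField (Subgroup.zpowers (absRestrictNormalHom (W.divisionField 5) σu *
        (absRestrictNormalHom (W.divisionField 5) σv)⁻¹) ⊔ Subgroup.zpowers (absRestrictNormalHom (W.divisionField 5) σu *
        absRestrictNormalHom (W.divisionField 5) σu * absRestrictNormalHom (W.divisionField 5) σw))))
    (hvZ : haveI : NumberField ↥(W.divisionField 5) := NumberField.mk
      ∃! v : IsDedekindDomain.HeightOneSpectrum (𝓞 ↥(fixedField (Subgroup.zpowers (absRestrictNormalHom (W.divisionField 5) σu *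
        (absRestrictNormalHom (W.divisionField 5) σv)⁻¹) ⊔ Subgroup.zpowers (absRestrictNormalHom (W.divisionField 5) σu *
        absRestrictNormalHom (W.divisionField 5) σu * absRestrictNormalHom (W.divisionField 5) σw)))),
        ((5 : ℕ) : 𝓞 ↥(fixedField (Subgroup.zpowers (absRestrictNormalHom (W.divisionField 5) σu *
        (absRestrictNormalHom (W.divisionField 5) σv)⁻¹) ⊔ Subgroup.zpowers (absRestrictNormalHom (W.divisionField 5) σu *
        absRestrictNormalHom (W.divisionField 5) σu * absRestrictNormalHom (W.divisionField 5) σw)))) ∈ v.asIdeal)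
    (hrkQ : haveI : NumberField ↥(W.divisionField 5) := NumberField.mk
      ∀ κE : ZpExtension ↥(fixedField (Subgroup.zpowers (absRestrictNormalHom (W.divisionField 5) σu *
        (absRestrictNormalHom (W.divisionField 5) σv)⁻¹) ⊔ Subgroup.zpowers (absRestrictNormalHom (W.divisionField 5) σw *
        absRestrictNormalHom (W.divisionField 5) σu))) 5,
        κE.IsCyclotomic → classGroupPRank κE (1 + 1) = classGroupPRank κE 1) :
    MissingUpperBoundAt W 5 := by
  subst hWeq
  haveI : Fact (Nat.Prime 5) := ⟨by norm_num⟩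
  exact CartanMuRoadSplitFiveAbelDoors.missingUpperBoundAt_five_tame_of_splitCartanBasis_of_classData _ hKatoA hGZK hmod hr
    addv_g283200gf1_5 subTprime_g283200gf1_5 irr_g283200gf1_5 e he σu σv σw hσu hσv hσw hhP hvP hhD hvD hhC hvC hhK hvK hhZ hvZ 1 hrkQ

end Summit.BirchSwinnertonDyer.BirchSwinnertonDyer.Theorems.TameConjAFiveRecords

end
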